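import Summits.HubbardSuperconductivity.HubbardSuperconductivity.Theorems.AnisotropyChordTransferFibre3N1RowObjA
import Summits.HubbardSuperconductivity.HubbardSuperconductivity.Theorems.AnisotropyChordTransferFibre3PC0Outer

/-!
# Route `AnisotropyChord` / H0 rotor rung, LEVEL 2 row `N₁`: the BLOCK KERNEL `|φ̂_e(k)|²` at the true vector

Object-layer soundness for the energy-current kernel shared by `Q̂₁` (part 3, `…N1RowExprQ`) and `Ĵ₁` (part 4, `…N1RowExprJ`):
for a ground two-magnon profile, the true vector `X = xTrue L Δ λ₂ f a` (`a = Δf(x̂)`, `t = θ²`), a grid point `q`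
(`k = toTor q`, `|q|∞ ≤ 3`) and a direction `e ∈ E4` (`toTor e ∈ nnList`):
* scalars: `eval_eta` (`eta ↦ η_eff`), `eval_qq` (`qq ↦ qPar`), `eval_taubar` (`taubar ↦ τ̄ = tauBar`);
* phases: `phase_re_toTor` (`Re e^{ik·e} = cos((q·e)θ)`), `eval_wOf` (`w_n ↦ (1 − cos nθ)/t`), `one_sub_phase_re`;
* `eval_tTerm` (`tTerm ↦ t·t(k)`), ★ `eval_m2` (`m2 ↦ t·|μ_e(k)|²`, `MuNormSq`), ★ `eval_p1` (`p1 ↦ √t·P_e(k)`,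
  `P_e = ‖1 − z‖/2·|t(k)| + τ̄/2`), and ★★ `ker_bounds`: `kerLo.eval X ≤ t·|φ̂_e(k)|² ≤ kerHi.eval X` (`PhiHatNearClosed`).
Prover seat `hubbard-h0-rotor-p2` g5; helper for piece A = stmt-HubbardSuperconductivity-23918 of rung 19089
(`--supports`, helper class).  Nothing here proves superconductivity in the Hubbard model; helper lemmas of ONE conditional
reduction (the GM₃ ∀L certificate, Level-2 row `N₁`); the rotor TARGET as originally worded stays FALSE (g15 verdict).
Mathlib + the tree only; no sorry.
-/

set_option linter.dupNamespace false
set_option autoImplicit false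

open Literature.Analysis.ValidatedNumerics

namespace Summit.HubbardSuperconductivity.HubbardSuperconductivity.Theorems.AnisotropyChord.Transfer.Fibre3.L2.N1

variable (L : ℕ) [NeZero L] (Δ lam2 : ℝ) (f : Tor L → ℝ)

/-! ## Scalars -/

/-- `eta ↦ η_eff = π²ν`. -/
theorem eval_eta (hL : 1 ≤ L) (a : ℝ) : eta.eval (xTrue L Δ lam2 f a) = etaEff L lam2 := by
  have hLpos : (0 : ℝ) < L := by exact_mod_cast (show 0 < L by omega)
  have hX1 : xTrue L Δ lam2 f a 1 = Real.pi ^ 2 := by rw [xTrue_lt16 L Δ lam2 f a (by norm_num)]; rfl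
  have hX2 : xTrue L Δ lam2 f a 2 = lam2 / (2 * Real.pi / L) ^ 2 := by rw [xTrue_lt16 L Δ lam2 f a (by norm_num)]; rfl
  simp only [eta, RExpr.eval, vPi2, vNu]
  rw [hX1, hX2]
  unfold etaEff
  have hπ : Real.pi ≠ 0 := Real.pi_ne_zero
  field_simp
  ring

/-- `qq ↦ q = Δf_nn²(Δ + 2(1 − Δ))` (manifold dictionary (iv)). -/
theorem eval_qq (hL : 5 ≤ L) (hΔ0 : 0 ≤ Δ) (hΔ1 : Δ < 1) (hf : IsGroundTwoMagnon L Δ lam2 f) :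
    qq.eval (xTrue L Δ lam2 f (Δ * f (K1 L))) = qPar L Δ f := by
  obtain ⟨_, _, _, dq, _, _, _⟩ := ManifoldA.manifold_dictionary L hL hΔ0 hΔ1 hf
  have hX3 : xTrue L Δ lam2 f (Δ * f (K1 L)) 3 = Δ * f (K1 L) := by rw [xTrue_lt16 L Δ lam2 f _ (by norm_num)]; rfl
  have he := eval_eta L Δ lam2 f (by omega) (Δ * f (K1 L))
  have e : qq.eval (xTrue L Δ lam2 f (Δ * f (K1 L))) = (xTrue L Δ lam2 f (Δ * f (K1 L)) 3) ^ 2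
      + 2 * eta.eval (xTrue L Δ lam2 f (Δ * f (K1 L))) * xTrue L Δ lam2 f (Δ * f (K1 L)) 3 := by
    simp only [qq, dd, RExpr.eval, cst, vA]; push_cast; ring
  rw [e, he, hX3]
  unfold qPar
  rw [dq]; ring

/-- `taubar ↦ τ̄ = tauBar`. -/
theorem eval_taubar (hL : 5 ≤ L) (hΔ0 : 0 ≤ Δ) (hΔ1 : Δ < 1) (hf : IsGroundTwoMagnon L Δ lam2 f) (hlam : 0 < lam2) :
    taubar.eval (xTrue L Δ lam2 f (Δ * f (K1 L))) = tauBar L Δ lam2 f := by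
  set X := xTrue L Δ lam2 f (Δ * f (K1 L)) with hXdef
  obtain ⟨deps, _, _, ddd, dsig⟩ := dict_at_xTrue L Δ lam2 f hL hΔ0 hΔ1 hf hlam
  have hX1 : X 1 = Real.pi ^ 2 := by rw [hXdef, xTrue_lt16 L Δ lam2 f _ (by norm_num)]; rfl
  have hX3 : X 3 = Δ * f (K1 L) := by rw [hXdef, xTrue_lt16 L Δ lam2 f _ (by norm_num)]; rfl
  have he := eval_eta L Δ lam2 f (by omega) (Δ * f (K1 L))
  have hLpos : (0 : ℝ) < L := by exact_mod_cast (show 0 < L by omega)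
  have e : taubar.eval X = 2 * eta.eval X * (1 + -X 3 + (2 * X 3 - dd.eval X) * eps.eval X
      + sig.eval X * (4 * X 1)⁻¹) := by
    simp only [taubar, rsum, RExpr.eval, cst, vA, vPi2]; push_cast; ring
  rw [e, he, hX3, ddd, deps, dsig, hX1]
  unfold tauBar aPar
  have hπ : Real.pi ≠ 0 := Real.pi_ne_zero
  field_simp
  ring

/-! ## Directions, phases and the cosine unknowns `w_n` -/

omit [NeZero L] in
/-- the `E4` directions read on the torus are the nearest-neighbour list. -/
theorem toTor_mem_nnList {e : ℤ × ℤ} (he : e ∈ E4) : B1.toTor L e ∈ nnList L := by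
  simp only [E4, List.mem_cons, List.mem_nil_iff, or_false] at he
  rcases he with h | h | h | h <;> subst h <;> simp [B1.toTor, nnList]

omit [NeZero L] in
/-- `nnList = E4.map toTor` (same order). -/
theorem nnList_eq_map : nnList L = E4.map (B1.toTor L) := by
  simp [nnList, E4, B1.toTor]

/-- ★ `Re e^{ik·e} = cos((q·e)θ)` for `k = toTor q`, `e ∈ E4`. -/
theorem phase_re_toTor (q : ℤ × ℤ) {e : ℤ × ℤ} (he : e ∈ E4) :
    (phase L (B1.toTor L q) (B1.toTor L e)).re = Real.cos ((qdot q e : ℤ) * (2 * Real.pi / L)) := by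
  obtain ⟨t1, t2, t3, t4, -, -, -, -⟩ := toTor_named L
  have h1 : (phase L (B1.toTor L q) (ex L)).re = Real.cos ((q.1 : ℝ) * (2 * Real.pi / L)) := by
    rw [phase_ex_re]
    unfold B1.toTor; dsimp only
    rw [show 2 * Real.pi * (((q.1 : ℤ) : ZMod L).val : ℝ) / L = 2 * Real.pi * (((q.1 : ℤ) : ZMod L).val : ℝ) / L - 0 by ring,
      cos_two_pi_val_intCast_sub L q.1 0]
    congr 1; ring
  have h2 : (phase L (B1.toTor L q) (ey L)).re = Real.cos ((q.2 : ℝ) * (2 * Real.pi / L)) := by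
    rw [phase_ey_re]
    unfold B1.toTor; dsimp only
    rw [show 2 * Real.pi * (((q.2 : ℤ) : ZMod L).val : ℝ) / L = 2 * Real.pi * (((q.2 : ℤ) : ZMod L).val : ℝ) / L - 0 by ring,
      cos_two_pi_val_intCast_sub L q.2 0]
    congr 1; ring
  simp only [E4, List.mem_cons, List.mem_nil_iff, or_false] at he
  rcases he with h | h | h | h <;> subst h
  · rw [t1, h1]; simp [qdot]
  · rw [t2, phase_re_neg, h1]; simp [qdot, Real.cos_neg]
  · rw [t3, h2]; simp [qdot]
  · rw [t4, phase_re_neg, h2]; simp [qdot, Real.cos_neg]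

/-- ★ `wOf n ↦ (1 − cos nθ)/θ²` for `|n| ≤ 3`. -/
theorem eval_wOf (a : ℝ) (n : ℤ) (hn : n.natAbs ≤ 3) :
    (wOf 3 n).eval (xTrue L Δ lam2 f a) = (1 - Real.cos ((n : ℝ) * (2 * Real.pi / L))) / (2 * Real.pi / L) ^ 2 := by
  unfold wOf
  by_cases h0 : n = 0
  · subst h0; simp [cst, RExpr.eval]
  · rw [if_neg h0]
    have hpos : 1 ≤ n.natAbs := Int.natAbs_pos.2 h0
    simp only [vW, RExpr.eval, length_gridPts_three]
    rw [show 19 + 2 * 48 + 3 + (n.natAbs - 1) = 118 + (n.natAbs - 1) by omega,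
      xTrue_w L Δ lam2 f a (by omega), show n.natAbs - 1 + 1 = n.natAbs by omega]
    rcases Int.natAbs_eq n with h | h
    · rw [h]; simp
    · rw [h]; simp [Real.cos_neg]

/-- `|q·e| ≤ 3` on the grid. -/
theorem natAbs_qdot_le : ∀ q ∈ gridPts 3, ∀ e ∈ E4, (qdot q e).natAbs ≤ 3 := by decide

/-- ★ `1 − Re e^{ik·e} = t·w_{q·e}` and `1 + Re e^{ik·e} = 2 − t·w_{q·e}` at the true vector. -/
theorem one_sub_phase_re (a : ℝ) {q e : ℤ × ℤ} (hq : q ∈ gridPts 3) (he : e ∈ E4) :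
    1 - (phase L (B1.toTor L q) (B1.toTor L e)).re = (2 * Real.pi / L) ^ 2 * (wOf 3 (qdot q e)).eval (xTrue L Δ lam2 f a) := by
  have hLpos : (0 : ℝ) < L := by exact_mod_cast Nat.pos_of_ne_zero (NeZero.ne L)
  have hθ2 : (2 * Real.pi / (L : ℝ)) ^ 2 ≠ 0 := by positivity
  rw [phase_re_toTor L q he, eval_wOf L Δ lam2 f a _ (natAbs_qdot_le q hq e he)]
  field_simp

/-! ## The tail term and the closed modulus -/

/-- ★ `tTerm ↦ t·t(k)` on the grid (exact named tail or the unknown coordinate). -/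
theorem eval_tTerm (hL : 5 ≤ L) (hΔ0 : 0 ≤ Δ) (hΔ1 : Δ < 1) (hf : IsGroundTwoMagnon L Δ lam2 f) (hlam : 0 < lam2)
    {q : ℤ × ℤ} (hq : q ∈ gridPts 3) :
    (tTerm 3 q).eval (xTrue L Δ lam2 f (Δ * f (K1 L))) = (2 * Real.pi / L) ^ 2 * tfun L Δ f (B1.toTor L q) := by
  unfold tTerm
  by_cases hn : isNamed q = true
  · rw [if_pos hn, eval_tnamed L Δ lam2 f hL hΔ0 hΔ1 hf hlam hq hn]
  · rw [if_neg hn, eval_vTt L Δ lam2 f hq]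

/-- ★ `m2 ↦ t·|μ_e(k)|²` (`MuNormSq`). -/
theorem eval_m2 (hL : 5 ≤ L) (hΔ0 : 0 ≤ Δ) (hΔ1 : Δ < 1) (hf : IsGroundTwoMagnon L Δ lam2 f) (hlam : 0 < lam2)
    {q e : ℤ × ℤ} (hq : q ∈ gridPts 3) (he : e ∈ E4) :
    (m2 3 q e).eval (xTrue L Δ lam2 f (Δ * f (K1 L)))
      = (2 * Real.pi / L) ^ 2 * Complex.normSq (muK L Δ lam2 f (B1.toTor L e) (B1.toTor L q)) := by
  set X := xTrue L Δ lam2 f (Δ * f (K1 L)) with hXdef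
  obtain ⟨_, _, hb⟩ := eval_closed L Δ lam2 f hL hΔ0 hΔ1 hf hlam hq
  have hqq := eval_qq L Δ lam2 f hL hΔ0 hΔ1 hf
  have hX0 : X 0 = (2 * Real.pi / L) ^ 2 := xTrue_zero L Δ lam2 f _
  have hw := one_sub_phase_re L Δ lam2 f (Δ * f (K1 L)) hq he
  rw [OuterMaj.muNormSq_holds L Δ lam2 f (B1.toTor L e) (B1.toTor L q)]
  have e1 : (m2 3 q e).eval X = 2 * (wOf 3 (qdot q e)).eval X * (bh 3 q).eval X ^ 2
      + 1 / 2 * qq.eval X ^ 2 * X 0 * (2 - X 0 * (wOf 3 (qdot q e)).eval X) := by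
    simp only [m2, RExpr.eval, cst, vT]; push_cast; ring
  rw [e1, hb, hqq, hX0]
  set w := (wOf 3 (qdot q e)).eval X
  have hre : (phase L (B1.toTor L q) (B1.toTor L e)).re = 1 - (2 * Real.pi / L) ^ 2 * w := by rw [← hw]; ring
  rw [hre]; ring

/-- `‖1 − z‖ = √(2(1 − Re φ))`. -/
theorem norm_one_sub_zPh (k e : Tor L) : ‖(1 : ℂ) - zPh L k e‖ = Real.sqrt (2 * (1 - (phase L k e).re)) := by
  rw [← OuterMaj.normSq_one_sub_zPh, Complex.normSq_eq_norm_sq, Real.sqrt_sq (norm_nonneg _)]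

/-- ★ `p1 ↦ √t·P_e(k)`, `P_e(k) = ‖1 − z‖/2·|t(k)| + τ̄/2` (the `PhiHatNearClosed` radius). -/
theorem eval_p1 (hL : 5 ≤ L) (hΔ0 : 0 ≤ Δ) (hΔ1 : Δ < 1) (hf : IsGroundTwoMagnon L Δ lam2 f) (hlam : 0 < lam2)
    {q e : ℤ × ℤ} (hq : q ∈ gridPts 3) (he : e ∈ E4) :
    (p1 3 q e).eval (xTrue L Δ lam2 f (Δ * f (K1 L)))
      = Real.sqrt ((2 * Real.pi / L) ^ 2) *
        (‖(1 : ℂ) - zPh L (B1.toTor L q) (B1.toTor L e)‖ / 2 * |tfun L Δ f (B1.toTor L q)| + tauBar L Δ lam2 f / 2) := by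
  set X := xTrue L Δ lam2 f (Δ * f (K1 L)) with hXdef
  set θ : ℝ := 2 * Real.pi / L with hθ
  have hLpos : (0 : ℝ) < L := by exact_mod_cast (show 0 < L by omega)
  have hθpos : 0 < θ := by positivity
  have ht0 : 0 ≤ θ ^ 2 := by positivity
  have hX0 : X 0 = θ ^ 2 := xTrue_zero L Δ lam2 f _
  have htt := eval_tTerm L Δ lam2 f hL hΔ0 hΔ1 hf hlam hq
  have hτ := eval_taubar L Δ lam2 f hL hΔ0 hΔ1 hf hlam
  have hw := one_sub_phase_re L Δ lam2 f (Δ * f (K1 L)) hq he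
  set w := (wOf 3 (qdot q e)).eval X with hwdef
  have hw0 : 0 ≤ w := by
    have h1 : 0 ≤ 1 - (phase L (B1.toTor L q) (B1.toTor L e)).re := by
      rw [phase_re_toTor L q he]; linarith [Real.cos_le_one ((qdot q e : ℤ) * (2 * Real.pi / L))]
    rw [hw] at h1
    exact nonneg_of_mul_nonneg_right (by rwa [mul_comm] at h1) (by positivity)
  have e1 : (p1 3 q e).eval X = Real.sqrt (w * (1 / 2)) * |(tTerm 3 q).eval X| + Real.sqrt (X 0) * taubar.eval X * (1 / 2) := by
    simp only [p1, RExpr.eval, cst, vT]; push_cast; ring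
  rw [e1, htt, hτ, hX0, norm_one_sub_zPh, hw, abs_mul, abs_of_nonneg ht0, Real.sqrt_sq hθpos.le]
  -- `√(2θ²w) = θ·2·√(w/2)`
  have hs : Real.sqrt (2 * (θ ^ 2 * w)) = θ * (2 * Real.sqrt (w * (1 / 2))) := by
    rw [show 2 * (θ ^ 2 * w) = (θ * 2) ^ 2 * (w * (1 / 2)) by ring, Real.sqrt_mul (by positivity), Real.sqrt_sq (by positivity)]
    ring
  rw [hs]; ring

/-- ★★ THE KERNEL BOUNDS: `kerLo.eval X ≤ t·|φ̂_e(k)|² ≤ kerHi.eval X` (`k = toTor q ≠ 0`, ground profile, `L ≥ 7`). -/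
theorem ker_bounds (hL : 7 ≤ L) (hΔ0 : 0 ≤ Δ) (hΔ1 : Δ < 1) (hf : IsGroundTwoMagnon L Δ lam2 f) (hlam : 0 < lam2)
    {q e : ℤ × ℤ} (hq : q ∈ gridPts 3) (he : e ∈ E4) :
    (kerLo 3 q e).eval (xTrue L Δ lam2 f (Δ * f (K1 L)))
        ≤ (2 * Real.pi / L) ^ 2 * Complex.normSq (phiHat L f (B1.toTor L e) (B1.toTor L q)) ∧
    (2 * Real.pi / L) ^ 2 * Complex.normSq (phiHat L f (B1.toTor L e) (B1.toTor L q))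
        ≤ (kerHi 3 q e).eval (xTrue L Δ lam2 f (Δ * f (K1 L))) := by
  set X := xTrue L Δ lam2 f (Δ * f (K1 L)) with hXdef
  set θ : ℝ := 2 * Real.pi / L with hθ
  set k := B1.toTor L q
  set e' := B1.toTor L e
  have hLpos : (0 : ℝ) < L := by exact_mod_cast (show 0 < L by omega)
  have hθpos : 0 < θ := by positivity
  have hk : k ≠ 0 := by
    show B1.toTor L q ≠ 0
    have := B1.intCast_ne_zero_of_mem_zWindow L 3 (by omega) q (gridPts_three_window q hq)
    simpa [B1.toTor] using this
  -- `‖φ̂ − μ‖ ≤ P`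
  set P : ℝ := ‖(1 : ℂ) - zPh L k e'‖ / 2 * |tfun L Δ f k| + tauBar L Δ lam2 f / 2 with hPdef
  have hnear : ‖phiHat L f e' k - muK L Δ lam2 f e' k‖ ≤ P :=
    OuterMaj.phiHatNearClosed_holds L (by omega) hΔ0 lam2 f hf hlam e' (toTor_mem_nnList L he) k hk
  have hm2 : (m2 3 q e).eval X = θ ^ 2 * Complex.normSq (muK L Δ lam2 f e' k) := eval_m2 L Δ lam2 f (by omega) hΔ0 hΔ1 hf hlam hq he
  have hp1 : (p1 3 q e).eval X = Real.sqrt (θ ^ 2) * P := eval_p1 L Δ lam2 f (by omega) hΔ0 hΔ1 hf hlam hq he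
  rw [Real.sqrt_sq hθpos.le] at hp1
  -- `√m2 = θ‖μ‖`
  have hsq : Real.sqrt ((m2 3 q e).eval X) = θ * ‖muK L Δ lam2 f e' k‖ := by
    rw [hm2, Complex.normSq_eq_norm_sq, show θ ^ 2 * ‖muK L Δ lam2 f e' k‖ ^ 2 = (θ * ‖muK L Δ lam2 f e' k‖) ^ 2 by ring,
      Real.sqrt_sq (by positivity)]
  have hup : ‖phiHat L f e' k‖ ≤ ‖muK L Δ lam2 f e' k‖ + P := by
    have := norm_le_norm_add_norm_sub' (phiHat L f e' k) (muK L Δ lam2 f e' k)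
    rw [← norm_sub_rev] at hnear
    have h2 := norm_sub_rev (muK L Δ lam2 f e' k) (phiHat L f e' k)
    linarith [norm_add_le (muK L Δ lam2 f e' k) (phiHat L f e' k - muK L Δ lam2 f e' k),
      show phiHat L f e' k = muK L Δ lam2 f e' k + (phiHat L f e' k - muK L Δ lam2 f e' k) by ring]
  have hupθ : θ * ‖phiHat L f e' k‖ ≤ θ * ‖muK L Δ lam2 f e' k‖ + θ * P := by nlinarith
  have hlow : ‖muK L Δ lam2 f e' k‖ - P ≤ ‖phiHat L f e' k‖ := by
    have := norm_sub_norm_le (muK L Δ lam2 f e' k) (phiHat L f e' k)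
    rw [norm_sub_rev] at this
    linarith
  have hlowθ : θ * ‖muK L Δ lam2 f e' k‖ - θ * P ≤ θ * ‖phiHat L f e' k‖ := by nlinarith
  have hn2 : θ ^ 2 * Complex.normSq (phiHat L f e' k) = (θ * ‖phiHat L f e' k‖) ^ 2 := by
    rw [Complex.normSq_eq_norm_sq]; ring
  have hφ0 : 0 ≤ θ * ‖phiHat L f e' k‖ := by positivity
  constructor
  · have e1 : (kerLo 3 q e).eval X = (max (Real.sqrt ((m2 3 q e).eval X) - (p1 3 q e).eval X) 0) ^ 2 := by
      simp only [kerLo, RExpr.eval, cst]; push_cast; ring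
    rw [e1, hsq, hp1, hn2]
    have hm : max (θ * ‖muK L Δ lam2 f e' k‖ - θ * P) 0 ≤ θ * ‖phiHat L f e' k‖ := max_le hlowθ hφ0
    exact pow_le_pow_left₀ (le_max_right _ _) hm 2
  · have e1 : (kerHi 3 q e).eval X = (Real.sqrt ((m2 3 q e).eval X) + (p1 3 q e).eval X) ^ 2 := by
      simp only [kerHi, RExpr.eval]
    rw [e1, hsq, hp1, hn2]
    exact pow_le_pow_left₀ hφ0 hupθ 2

end Summit.HubbardSuperconductivity.HubbardSuperconductivity.Theorems.AnisotropyChord.Transfer.Fibre3.L2.N1
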